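import Literature.NumberTheory.Rogawski1990.FinExplicitTransferFactorEventuallyConst        -- ★ `finExplicitDelta_eventually_eq` (τ_v, D_v, κ_v locally constant)
import HarnessLib

/-!
# `Δ‴_v` is locally constant ALONG ANY CONTINUOUS MATCHED FAMILY of pairs — the torus-pair form of Rogawski's «`Δ(γ_H δ_t, γ δ_t)` is constant for `t` near `1`»
# (Rogawski 1990, §4.9 p. 55, Prop. 8.1.3 proof p. 116; Langlands–Shelstad 1987 Lemma 4.1.A)

Topic `NumberTheory/Rogawski1990`; namespace `Literature.NumberTheory.Rogawski1990`.  THEOREMS ONLY (no definition, no named fact, no instance, no notation,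
no `sorry`).  Cell `pub/hodgecm-mathlib`, programme P3a, road «D-N6-ns» floor 1, feeder **(G1-ii)** of the ONE junction file
`Rogawski1990/LocalTransferChartJunctionCM.lean` (p08 (g13) LEDGER «N6-ns FLOOR 1» §2 (J-c): the `hlc` binder of ★ `exists_transfer_of_chart` wants
`b ↦ (Δ‴ v).Δ (τ_H b) (x ι(τ_H b) x⁻¹)` locally constant on the `H`-box).  The substance — `τ_v`, `D_{G∕H,v}`, `κ_v` each locally constant near a matching pair with
`χ_g(u)` a unit — is ★ `FinExplicitTransferFactorEventuallyConst` (`finExplicitDelta_eventually_eq`, every finite `v`); this file is the DOCKING to families: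
pull the ★ head back along a continuous pair map `b ↦ (τ_H b, τ_G b)` matched on a set `B₁` (§1), and restate it for the member `(Δ‴ v).Δ` of the explicit
collection ★ `finExplicitCollection` (`TransferFactorData` currency of ★ `LocalTransfer`) that the junction quantifies over (§2).  HC_CM is proved only modulo
the printed citations until rung 0 closes; this file is local bookkeeping and proves none of them.

## References
* [Rogawski1990] J. D. Rogawski, *Automorphic Representations of Unitary Groups in Three Variables*, Ann. of Math. Stud. 123 (1990), §4.3 p. 43, §4.9 p. 55,
  Prop. 8.1.3 proof p. 116.
* [LanglandsShelstad1987] R. P. Langlands, D. Shelstad, *On the definition of transfer factors*, Math. Ann. 278 (1987), Lemma 4.1.A.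
-/

set_option autoImplicit false

noncomputable section

open NumberField IsDedekindDomain Matrix Polynomial Filter Topology
open scoped MatrixGroups

namespace Literature.NumberTheory.Rogawski1990

open Literature.NumberTheory.Automorphic
open Literature.NumberTheory.GaloisRepresentations

variable (L : Type) [Field L] [NumberField L] [IsCMField L] (v : HeightOneSpectrum (𝓞 ↥(maximalRealSubfield L)))
  (H' : Matrix (Fin 3) (Fin 3) L)

/-! ## §1 `Δ‴_v` along a continuous matched family -/

open scoped Classical in
/-- **`Δ‴_v` IS LOCALLY CONSTANT ALONG MATCHED FAMILIES.**  For any topological space `B`, continuous `τ_H : B → H_v` and `τ_G : B → G′_v`, and a set `B₁ ⊆ B` on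
which the pairs match (`ι_v(τ_H b) ↔ τ_G b`), at every `b ∈ B₁` with `χ_g(u)(τ_H b)` a unit: `∀ᶠ b′ in 𝓝 b, b′ ∈ B₁ → Δ‴_v(τ_H b′, τ_G b′) = Δ‴_v(τ_H b, τ_G b)`
(★ `finExplicitDelta_eventually_eq` pulled back along `b ↦ (τ_H b, τ_G b)`).  Typical use: `τ_H` the inclusion of an `H`-box in the centraliser torus of a
`G`-regular `γ_H`, `τ_G b = x · ι_v(τ_H b) · x⁻¹` a stable conjugate (★ `Corresponds.centralizerContinuousEquiv`) — print's «`Δ(γ_H δ_t, γ δ_t)` for `t` close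
to `1`». [cite: Rogawski1990, §4.3 p. 43; §4.9 p. 55; Prop. 8.1.3 proof p. 116] [cite: LanglandsShelstad1987, Lemma 4.1.A] -/
theorem finExplicitDelta_comp_eventually_eq (hH : (H'.map (cmConjRingHom L))ᵀ = H') (hdet : H'.det ≠ 0) (μ : HeckeCharacter L)
    {B : Type*} [TopologicalSpace B]
    {τH : B → (UnitaryGroup.cmDatum L 2 (Matrix.of fun i j : Fin 2 => if i.val + j.val + 1 = 2 then (1 : L) else 0)).Local v ×
      (UnitaryGroup.cmDatum L 1 (Matrix.of fun i j : Fin 1 => if i.val + j.val + 1 = 1 then (1 : L) else 0)).Local v}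
    {τG : B → (UnitaryGroup.cmDatum L 3 H').Local v} (hτH : Continuous τH) (hτG : Continuous τG)
    {B₁ : Set B} (hmatch : ∀ b ∈ B₁, IsLocalNormPair L H' v (τH b) (τG b)) {b : B} (hb : b ∈ B₁)
    (hu : IsUnit ((finCharpolyTwo L v (τH b)).eval (finGammaTwo L v (τH b)))) :
    ∀ᶠ b' in 𝓝 b, b' ∈ B₁ → finExplicitDelta L v H' (τH b') μ (τG b') = finExplicitDelta L v H' (τH b) μ (τG b) := by
  have h := finExplicitDelta_eventually_eq L v H' hH hdet μ (hmatch b hb) hu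
  have hpair : Tendsto (fun b' => (τH b', τG b')) (𝓝 b) (𝓝 (τH b, τG b)) := (hτH.prodMk hτG).continuousAt
  filter_upwards [hpair.eventually h] with b' hb' hmem
  exact hb' (hmatch b' hmem)

open scoped Classical in
/-- The same within the matched set: `b′ ↦ Δ‴_v(τ_H b′, τ_G b′)` is eventually equal to its value at `b` along `𝓝[B₁] b`.
[cite: Rogawski1990, Prop. 8.1.3 proof p. 116] [cite: LanglandsShelstad1987, Lemma 4.1.A] -/
theorem finExplicitDelta_comp_eventuallyEq_nhdsWithin (hH : (H'.map (cmConjRingHom L))ᵀ = H') (hdet : H'.det ≠ 0) (μ : HeckeCharacter L)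
    {B : Type*} [TopologicalSpace B]
    {τH : B → (UnitaryGroup.cmDatum L 2 (Matrix.of fun i j : Fin 2 => if i.val + j.val + 1 = 2 then (1 : L) else 0)).Local v ×
      (UnitaryGroup.cmDatum L 1 (Matrix.of fun i j : Fin 1 => if i.val + j.val + 1 = 1 then (1 : L) else 0)).Local v}
    {τG : B → (UnitaryGroup.cmDatum L 3 H').Local v} (hτH : Continuous τH) (hτG : Continuous τG)
    {B₁ : Set B} (hmatch : ∀ b ∈ B₁, IsLocalNormPair L H' v (τH b) (τG b)) {b : B} (hb : b ∈ B₁)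
    (hu : IsUnit ((finCharpolyTwo L v (τH b)).eval (finGammaTwo L v (τH b)))) :
    (fun b' => finExplicitDelta L v H' (τH b') μ (τG b')) =ᶠ[𝓝[B₁] b] fun _ => finExplicitDelta L v H' (τH b) μ (τG b) := by
  rw [EventuallyEq, eventually_nhdsWithin_iff]
  exact finExplicitDelta_comp_eventually_eq L v H' hH hdet μ hτH hτG hmatch hb hu

/-- **All along a matched family of `(G,H)`-regular pairs, `Δ‴_v` is locally constant** (`IsLocallyConstant` on the subtype `↥B₁`, when EVERY `b ∈ B₁` has
`χ_g(u)(τ_H b)` a unit — e.g. an `H`-box inside the `G`-regular part of the torus). [cite: Rogawski1990, Prop. 8.1.3 proof p. 116] [cite: LanglandsShelstad1987, Lemma 4.1.A] -/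
theorem isLocallyConstant_finExplicitDelta_comp (hH : (H'.map (cmConjRingHom L))ᵀ = H') (hdet : H'.det ≠ 0) (μ : HeckeCharacter L)
    {B : Type*} [TopologicalSpace B]
    {τH : B → (UnitaryGroup.cmDatum L 2 (Matrix.of fun i j : Fin 2 => if i.val + j.val + 1 = 2 then (1 : L) else 0)).Local v ×
      (UnitaryGroup.cmDatum L 1 (Matrix.of fun i j : Fin 1 => if i.val + j.val + 1 = 1 then (1 : L) else 0)).Local v}
    {τG : B → (UnitaryGroup.cmDatum L 3 H').Local v} (hτH : Continuous τH) (hτG : Continuous τG)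
    {B₁ : Set B} (hmatch : ∀ b ∈ B₁, IsLocalNormPair L H' v (τH b) (τG b))
    (hu : ∀ b ∈ B₁, IsUnit ((finCharpolyTwo L v (τH b)).eval (finGammaTwo L v (τH b)))) :
    IsLocallyConstant fun b : B₁ => finExplicitDelta L v H' (τH b) μ (τG b) := by
  refine (IsLocallyConstant.iff_eventually_eq _).2 fun b => ?_
  have h := finExplicitDelta_comp_eventually_eq L v H' hH hdet μ hτH hτG hmatch b.2 (hu b b.2)
  have hval : Tendsto (fun b' : B₁ => (b' : B)) (𝓝 b) (𝓝 (b : B)) := continuous_subtype_val.continuousAt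
  filter_upwards [hval.eventually h] with b' hb'
  exact hb' b'.2

/-! ## §2 The same for the member `(Δ‴ v).Δ` of the explicit collection -/

open scoped Classical in
/-- **`(Δ‴ v).Δ` is eventually constant along matching pairs** near a matching pair with `χ_g(u)` a unit — ★ `finExplicitDelta_eventually_eq` in the
`TransferFactorData` currency of ★ `finExplicitCollection` (★ `finExplicitCollection_Δ`, definitional). [cite: Rogawski1990, §4.9 p. 55; Prop. 8.1.3 proof p. 116] [cite: LanglandsShelstad1987, Lemma 4.1.A] -/
theorem finExplicitCollection_Δ_eventually_eq (hH : (H'.map (cmConjRingHom L))ᵀ = H') (hdet : H'.det ≠ 0) (μ : HeckeCharacter L)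
    (hl : ∀ (v : HeightOneSpectrum (𝓞 ↥(maximalRealSubfield L)))
      (a : (UnitaryGroup.cmDatum L 2 (Matrix.of fun i j : Fin 2 => if i.val + j.val + 1 = 2 then (1 : L) else 0)).Local v ×
        (UnitaryGroup.cmDatum L 1 (Matrix.of fun i j : Fin 1 => if i.val + j.val + 1 = 1 then (1 : L) else 0)).Local v)
      (b : (UnitaryGroup.cmDatum L 3 H').Local v)
      (x : (UnitaryGroup.cmDatum L 2 (Matrix.of fun i j : Fin 2 => if i.val + j.val + 1 = 2 then (1 : L) else 0)).Local v ×
        (UnitaryGroup.cmDatum L 1 (Matrix.of fun i j : Fin 1 => if i.val + j.val + 1 = 1 then (1 : L) else 0)).Local v),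
      finExplicitDelta L v H' (x * a * x⁻¹) μ b = finExplicitDelta L v H' a μ b)
    (hr : ∀ (v : HeightOneSpectrum (𝓞 ↥(maximalRealSubfield L)))
      (a : (UnitaryGroup.cmDatum L 2 (Matrix.of fun i j : Fin 2 => if i.val + j.val + 1 = 2 then (1 : L) else 0)).Local v ×
        (UnitaryGroup.cmDatum L 1 (Matrix.of fun i j : Fin 1 => if i.val + j.val + 1 = 1 then (1 : L) else 0)).Local v)
      (b y : (UnitaryGroup.cmDatum L 3 H').Local v),
      finExplicitDelta L v H' a μ (y * b * y⁻¹) = finExplicitDelta L v H' a μ b)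
    {a₀ : (UnitaryGroup.cmDatum L 2 (Matrix.of fun i j : Fin 2 => if i.val + j.val + 1 = 2 then (1 : L) else 0)).Local v ×
      (UnitaryGroup.cmDatum L 1 (Matrix.of fun i j : Fin 1 => if i.val + j.val + 1 = 1 then (1 : L) else 0)).Local v}
    {b₀ : (UnitaryGroup.cmDatum L 3 H').Local v} (h₀ : IsLocalNormPair L H' v a₀ b₀)
    (hu₀ : IsUnit ((finCharpolyTwo L v a₀).eval (finGammaTwo L v a₀))) :
    ∀ᶠ q in 𝓝 (a₀, b₀), IsLocalNormPair L H' v q.1 q.2 →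
      (finExplicitCollection L H' μ hl hr v).Δ q.1 q.2 = (finExplicitCollection L H' μ hl hr v).Δ a₀ b₀ := by
  simp only [finExplicitCollection_Δ]
  exact finExplicitDelta_eventually_eq L v H' hH hdet μ h₀ hu₀

open scoped Classical in
/-- **`(Δ‴ v).Δ` along a continuous matched family** — the `hlc` Δ-factor of the junction in its own currency: `∀ᶠ b′ in 𝓝 b, b′ ∈ B₁ →
(Δ‴ v).Δ (τ_H b′) (τ_G b′) = (Δ‴ v).Δ (τ_H b) (τ_G b)`. [cite: Rogawski1990, §4.3 p. 43; Prop. 8.1.3 proof p. 116] [cite: LanglandsShelstad1987, Lemma 4.1.A] -/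
theorem finExplicitCollection_Δ_comp_eventually_eq (hH : (H'.map (cmConjRingHom L))ᵀ = H') (hdet : H'.det ≠ 0) (μ : HeckeCharacter L)
    (hl : ∀ (v : HeightOneSpectrum (𝓞 ↥(maximalRealSubfield L)))
      (a : (UnitaryGroup.cmDatum L 2 (Matrix.of fun i j : Fin 2 => if i.val + j.val + 1 = 2 then (1 : L) else 0)).Local v ×
        (UnitaryGroup.cmDatum L 1 (Matrix.of fun i j : Fin 1 => if i.val + j.val + 1 = 1 then (1 : L) else 0)).Local v)
      (b : (UnitaryGroup.cmDatum L 3 H').Local v)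
      (x : (UnitaryGroup.cmDatum L 2 (Matrix.of fun i j : Fin 2 => if i.val + j.val + 1 = 2 then (1 : L) else 0)).Local v ×
        (UnitaryGroup.cmDatum L 1 (Matrix.of fun i j : Fin 1 => if i.val + j.val + 1 = 1 then (1 : L) else 0)).Local v),
      finExplicitDelta L v H' (x * a * x⁻¹) μ b = finExplicitDelta L v H' a μ b)
    (hr : ∀ (v : HeightOneSpectrum (𝓞 ↥(maximalRealSubfield L)))
      (a : (UnitaryGroup.cmDatum L 2 (Matrix.of fun i j : Fin 2 => if i.val + j.val + 1 = 2 then (1 : L) else 0)).Local v ×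
        (UnitaryGroup.cmDatum L 1 (Matrix.of fun i j : Fin 1 => if i.val + j.val + 1 = 1 then (1 : L) else 0)).Local v)
      (b y : (UnitaryGroup.cmDatum L 3 H').Local v),
      finExplicitDelta L v H' a μ (y * b * y⁻¹) = finExplicitDelta L v H' a μ b)
    {B : Type*} [TopologicalSpace B]
    {τH : B → (UnitaryGroup.cmDatum L 2 (Matrix.of fun i j : Fin 2 => if i.val + j.val + 1 = 2 then (1 : L) else 0)).Local v ×
      (UnitaryGroup.cmDatum L 1 (Matrix.of fun i j : Fin 1 => if i.val + j.val + 1 = 1 then (1 : L) else 0)).Local v}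
    {τG : B → (UnitaryGroup.cmDatum L 3 H').Local v} (hτH : Continuous τH) (hτG : Continuous τG)
    {B₁ : Set B} (hmatch : ∀ b ∈ B₁, IsLocalNormPair L H' v (τH b) (τG b)) {b : B} (hb : b ∈ B₁)
    (hu : IsUnit ((finCharpolyTwo L v (τH b)).eval (finGammaTwo L v (τH b)))) :
    ∀ᶠ b' in 𝓝 b, b' ∈ B₁ →
      (finExplicitCollection L H' μ hl hr v).Δ (τH b') (τG b') = (finExplicitCollection L H' μ hl hr v).Δ (τH b) (τG b) := by
  simp only [finExplicitCollection_Δ]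
  exact finExplicitDelta_comp_eventually_eq L v H' hH hdet μ hτH hτG hmatch hb hu

end Literature.NumberTheory.Rogawski1990

end
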